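import Literature.MathematicalPhysics.QuantumFieldTheory.Balaban1983to89.B6Prop22SixMultiLevelBoxRateUnifL0
import Literature.MathematicalPhysics.QuantumFieldTheory.Balaban1983to89.B6Prop22SeriesMultiLevelBox
/-!
# `Balaban1983to89.B6Prop22SeriesMultiLevelBoxL0` — LEVEL-0 TWIN (programme G-F3′-L0, director-ym LINE №27 / UV3-NODE §24.5; plan `lit-balaban-r03/G-F3L0-PLAN.md`) of `B6Prop22SeriesMultiLevelBox`:
the same declarations, SAME NAMES AND STATEMENTS, for nested families WITH print's region `Λ₀ = T ∖ Ω₁` ADMITTED (structures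
`B6MultiLevelBoxOperatorL0.Domains` / `B6MultiLevelTorusOperatorL0.TDomains`: levels `0, …, k`, the level-`0` block a single site, `Q′₀ = id`,
finite weight `a₀` — print p.225 (2.14) «Σ_{j=0}^k … (Q′₀λ)(x) = λ(x), x ∈ Λ₀», p.229 «taking a sequence (2.1) … smallest possible domains B^j(Λ_j),
and considering the operator Δ_a defined by (2.19), (2.20) for this sequence»).  Every `D`-free object is the lineage's, consumed BY NAME; no existing
module is touched; no fact is minted.  Unit `lit-balaban-p21` (packet S-B owner, p21 gen 26; port tooling by r03 gen 36); B6 fold owner r03; referee ref-4.  THE TWIN'S DOCUMENTATION FOLLOWS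
VERBATIM (its «levels 1 … k» / «Ω₁ = X» sentences describe the twin; here `j` runs from `0` and `Ω₁` may be a proper subset).

# `Balaban1983to89.B6Prop22SeriesMultiLevelBox` — [B6] PROPOSITION 2.2, THE CONVERGENCE CLAUSE «The random walk
representation (2.50) is convergent in the norms defined by these inequalities», FOR THE GENUINE `k`-LEVEL OPERATOR
`G′ = Δ′_a^{−1}` ON A BOX — QUANTITATIVE FORM: the remainders `G′R^N = G′ − G′₀Σ_{n<N}Rⁿ` of (2.50) decay like `2^{−N}`
in the majorant norms of the first, second and fourth entries of (2.67) (no existing module is touched; no fact is minted)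

FRAMING (verbatim cell line):
statement-level skeleton of published theorems with citation tags; proofs where landed; nothing here is a claim about the Yang–Mills mass gap

Source under audit (cell pub-balaban / lit-balaban): T. Bałaban, *Propagators and renormalization transformations for
lattice gauge theories. II*, Commun. Math. Phys. **96** (1984) 223–250 [`Balaban1984PropagatorsII`, "B6"], p. 234
[PDF 12] (2.64)–(2.67), Proposition 2.2; p. 232 [PDF 10] (2.50)–(2.55) (renders
`run/shared/lean/pub/pub-balaban/b2b-balaban-ref1/pages/1984-cmp96-propagators-rt-II/…-p010/p012-x2.png`); [3] =
T. Bałaban, *Regularity and decay of lattice Green's functions*, Commun. Math. Phys. **89** (1983) 571–597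
[`Balaban1983RegularityDecay`], Theorem (1.9) p. 573.  PDF held: `paper:balaban1984-cmp96-propagators-rt-ii` (journal
page = PDF page + 222).  Unit `lit-balaban-p21` (Phase-2 proof seat p21 gen 12), HOME `run/shared/lean/pub/lit-balaban/`,
B6 fold owner r03 (rows **B6.Prop2.2**, **B6.Eq2.50**), referee ref-4.

## WHAT IS PRINTED (pp. 232, 234, verbatim up to notation)

p. 232: «G′ = G′₀(I − R)^{−1} = G′₀ Σ_{n=0}^∞ Rⁿ. (2.50)»; p. 234: «… |(G′λ)(x)| ≤ Σ_{n=0}^∞ |(G′₀Rⁿλ)(x)| ≤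
O(1)(L^jη)² e^{−½δ₀d(y,y′)}|λ|. (2.66) … **Proposition 2.2.** If we have (2.1), (2.2) and M is sufficiently large, then
the operator G′ = Δ′_a^{−1} (a = 1) satisfies the inequalities … (2.67)  The random walk representation (2.50) is
convergent in the norms defined by these inequalities.»

## WHAT THIS FILE CERTIFIES (kernel-checked)

* §1 `majorant_remainder_266W` — THE TAIL OF (2.66), generic: for any `G′ = G₀ + G′R` on a finite lattice with majorants
  `A·P(y)e^{−δ₀d}` of `G₀` and `θe^{−δ₀d}` of `R`, (2.61)/(2.63) with a constant `c` and `θc < 1`, the remainder `G′R^N`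
  has majorant `A c (θc)^N (1 − θc)^{−1} P(y) e^{−(1−α)δ₀d(y,y′)}` for every `N` (the proof of
  `B6Prop23Chain.majorant_of_fixedPoint_266W` run on the fixed point `G′R^N = G₀R^N + (G′R^N)R`: partial sums (2.65)–(2.66)
  from `N` on, the far remainder killed by the operator bound); `partialSum_add_remainder` — the algebra
  `G′ = G₀Σ_{n<N}Rⁿ + G′R^N`.
* §2 THE GENUINE `k`-LEVEL OPERATOR (`gml`, `gZeroML`, `rML` of files 1–5): `prop22_series_first_multiLevelBox` — there are
  `δ₀, C, M₀ > 0`, `N₀ ≥ 1` with, for every `k`, `M_h ≥ 3`, `L·M_h ≥ M₀`, `R ≥ 2L`, `RM ≥ N₀ + 1`, volume, nested family `D`,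
  weights in the windows (`a_{i+1} = aNext ℓ a_i c_i`) and EVERY `N`: the remainder `G′R^N` has majorant
  `C·2^{−N}·L^{2j}·e^{−½δ₀d(y,y′)}` on the blocks AND `G′` itself the majorant `C·L^{2j}·e^{−½δ₀d(y,y′)}` (the first entry,
  same constants); `prop22_series_second_multiLevelBox` — the same for `∇_μG′` (`∇_μG′R^N`: `C·2^{−N}·L^{j}`);
  `gml_eq_partialSum_add_remainder` — `G′ = G′₀Σ_{n<N}Rⁿ + G′R^N` as matrices, so the two theorems say: the partial sums of
  (2.50) converge to `G′` geometrically in the norms of the first two entries of (2.67).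
* §3 `prop22_series_fourth_multiLevelBox_unif` — the same for the lifted Hölder functional of the fourth entry, in print's
  quantifier order (`∃ δ₀ M₀ N₀ ∀ α ∈ [0,1) ∃ C(α)`): the pair functional of `∇_μ(G′R^N)` over the pairs of one block has
  majorant `C(α)·2^{−N}·(L^{j})^{1−α}·e^{−½δ₀d}` (`liftL T(G′) · (liftR R)^N = liftL T(G′R^N)`).

## HONEST SCOPE

Entries 1, 2, 4 of (2.67) only (the right fixed points `T = T₀ + T·R` of files 5, 6, 11); the third, fifth and sixth
entries (transposed/conjugated fixed points, files 9, 13, 7) are NOT treated here.  Otherwise as files 1–14 of the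
lineage: levels `1 … k` on a Neumann box, `m² = 0`, the asymmetric partition, `M_h ≥ 3`, `R ≥ 2L`, lattice units
(`L^{2j}`, `L^{j}`, `(L^{j})^{1−α}` for «(L^jη)²», «L^jη», «(L^jη)^{1−α}»), `L`-dependent (2.61)-constant, «M sufficiently
large» `= 2Kc + 1` so that `θc ≤ ½` (whence the ratio `½`), constants existential.  Nothing is inferred from the
manuscript: every step is kernel-checked.  NOT summit progress.
-/

namespace Literature.MathematicalPhysics.QuantumFieldTheory.Balaban1983to89.B6Prop22SeriesMultiLevelBoxL0

open Matrix
open Literature.MathematicalPhysics.QuantumFieldTheory.Balaban1983to89.B4Reflection242 (boxDom)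
open Literature.MathematicalPhysics.QuantumFieldTheory.Balaban1983to89.B4ContourShift (supNorm supNorm_nonneg)
open Literature.MathematicalPhysics.QuantumFieldTheory.Balaban1983to89.B6Ineq243TwoLevelBox (aNext)
open Literature.MathematicalPhysics.QuantumFieldTheory.Balaban1983to89.B6MultiLevelBoxOperator hiding Domains mlOp_apply
open Literature.MathematicalPhysics.QuantumFieldTheory.Balaban1983to89.B6MultiLevelBoxOperatorL0
open Literature.MathematicalPhysics.QuantumFieldTheory.Balaban1983to89.B6Eq238MultiLevelBox hiding Active CubeData Down Ep LamG aX bX cG cOp cOp_mul_cG ctrs_Pj_subset cubeData_of_mem cubeSet diagonal_mul_eq_pad eq238_multiLevelBox fin fin_data fin_spec gX gZeroML isBlockUnion_LamG lev_corner_ublk mem_LamG mem_cubeSet mlOp_emb_emb mlOp_emb_off mlOp_mul_aX mlOp_mul_term rML row_eq_pad_row sum_uv_eq_one vFun vX window_of_active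
open Literature.MathematicalPhysics.QuantumFieldTheory.Balaban1983to89.B6Eq238MultiLevelBoxL0
open Literature.MathematicalPhysics.QuantumFieldTheory.Balaban1983to89.B6Ineq249MultiLevelBox hiding abs_vFun_le_one bX_eq bX_mulVec_apply embC eq250_multiLevelBox innerB local_comm_bound mem_keySet_of_bX_ne_zero norm_rML_le
open Literature.MathematicalPhysics.QuantumFieldTheory.Balaban1983to89.B6Ineq249MultiLevelBoxL0
open Literature.MathematicalPhysics.QuantumFieldTheory.Balaban1983to89.B6Geom246MultiLevelBox hiding Touch blkOf blkOf_corner blkOf_eq_iff_blk blkOf_eq_of_blk_i_eq blkOf_val bond bond_adj bset cen connected coord_bounds corner corner_mem csys dist_blkOf_le_box dist_blkOf_le_coord dist_blkOf_le_line dist_cen_le_of_adj dist_cen_le_of_touch dist_le_one_of_near dist_toR_cen_le exists_blkOf_eq geom lemma21_box lev_corner lev_eq_of_blkOf_eq levelGap pack reachable_blkOf reachable_of_near realizes scale_bounds touch_symm triangle_refl_nonneg walk_disp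
open Literature.MathematicalPhysics.QuantumFieldTheory.Balaban1983to89.B6Geom246MultiLevelBoxL0
open Literature.MathematicalPhysics.QuantumFieldTheory.Balaban1983to89.B6Prop22MultiLevelBox hiding Dd_le_supNorm aX_mulVec_apply bX_row_img bX_row_off dist_blkOf_le_in_cube fixedPoint_gml gX_row_img gX_row_off gZeroML_majorant lev_window_of_inCube mem_keySet_of_aX_ne_zero prop22_first_multiLevelBox rML_majorant
open Literature.MathematicalPhysics.QuantumFieldTheory.Balaban1983to89.B6Prop22MultiLevelBoxL0
open Literature.MathematicalPhysics.QuantumFieldTheory.Balaban1983to89.B6Prop22DerivMultiLevelBox (dMat)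
open Literature.MathematicalPhysics.QuantumFieldTheory.Balaban1983to89.B6Prop22DerivMultiLevelBoxL0 (dMat_gZeroML_majorant fixedPoint_dMat_gml)
open Literature.MathematicalPhysics.QuantumFieldTheory.Balaban1983to89.B6Prop22HolderMultiLevelBox (liftL liftR liftL_mul_liftR hasMajorant_liftL hasMajorant_liftR rowBound_of_hasMajorant_liftL)
open Literature.MathematicalPhysics.QuantumFieldTheory.Balaban1983to89.B6Prop22HolderMultiLevelBoxL0 (HPair blkP holderOp holderOp_apply holderOp_mul fixedPoint_holder)
open Literature.MathematicalPhysics.QuantumFieldTheory.Balaban1983to89.B6Prop22HolderMultiLevelBoxRateUnif hiding aX_dd_le_unif hasMajorant_holder_multiLevelBox_unif holderZero_rowBound_unif prop22_fourth_multiLevelBox_unif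
open Literature.MathematicalPhysics.QuantumFieldTheory.Balaban1983to89.B6Prop22HolderMultiLevelBoxRateUnifL0
  (holderZero_rowBound_unif)
open Literature.MathematicalPhysics.QuantumFieldTheory.Balaban1983to89.B6RandomWalk (HasMajorant BlockSupp
  hasMajorant_mono hasMajorant_add hasMajorant_sum hasMajorant_mul Triangle254 exists_opBound fixedPoint_telescope)
open Literature.MathematicalPhysics.QuantumFieldTheory.Balaban1983to89.B6Lemma21Repaired (Ineq261With Ineq263With)
open Literature.MathematicalPhysics.QuantumFieldTheory.Balaban1983to89.B6Ineq261LevelGap (K261 K261_nonneg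
  theta_lt_one_of_log)
open Literature.MathematicalPhysics.QuantumFieldTheory.Balaban1983to89.B6Prop23Chain (majorant_pow_265W majorant_G0_mul_265W
  majorant_of_fixedPoint_266W)

open Literature.MathematicalPhysics.QuantumFieldTheory.Balaban1983to89.B6Prop22SeriesMultiLevelBox (partialSum_add_remainder majorant_remainder_266W)
noncomputable section

variable {d : ℕ}

/-! ## §1 The tail of (2.66): the remainder `G′R^N` of the random walk representation, generic constant -/

section Generic

variable {g : B6.Geometry} {X : Type}

end Generic

/-! ## §2 The genuine `k`-level operator: the remainders of (2.50) in the norms of the first two entries -/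

section KLevel

variable {ℓ Mh k R : ℕ} {P : Fin (d + 1) → ℕ}

/-- **(2.50) FOR THE GENUINE `k`-LEVEL OPERATOR, PARTIAL SUMS AND REMAINDER**: `G′ = G′₀Σ_{n<N}Rⁿ + G′R^N` as matrices
(`G′ = gml`, `G′₀ = gZeroML`, `R = rML`). [cite: Balaban1984PropagatorsII, (2.50) p.232, (2.38) p.229] -/
theorem gml_eq_partialSum_add_remainder (D : Domains d ℓ Mh k P R) {a c : ℕ → ℝ} (hℓ : 1 ≤ ℓ) (hR : 2 * (ℓ + 1) ≤ R)
    (hP : ∀ μ, 1 ≤ P μ) (hMh : 2 ≤ Mh) (ha : ∀ i, 0 < a i) (hcpos : ∀ i, 0 < c i)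
    (hac : ∀ i, a (i + 1) = aNext ℓ (a i) (c i)) (N : ℕ) :
    gml (N0 ℓ Mh k P) ℓ k D.lev a
      = gZeroML D a c hP * (∑ n ∈ Finset.range N, rML D a c hP ^ n) + gml (N0 ℓ Mh k P) ℓ k D.lev a * rML D a c hP ^ N := by
  have hfix := fixedPoint_gml D (c := c) hℓ hR hP hMh ha hcpos hac
  have h := partialSum_add_remainder hfix N
  apply Matrix.toLin'.injective
  rw [h, map_add, Matrix.toLin'_mul, Matrix.toLin'_mul, Matrix.toLin'_pow, map_sum]
  simp only [Matrix.toLin'_pow, Module.End.mul_eq_comp]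

/-- **[B6] PROPOSITION 2.2, CONVERGENCE CLAUSE, FIRST ENTRY, GENUINE `k`-LEVEL OPERATOR**: there are `δ₀, C, M₀ > 0`,
`N₀ ≥ 1` (functions of `d`, `ℓ`, the windows) such that for every `k`, `M_h ≥ 3` with `L·M_h ≥ M₀`, `R ≥ 2L` with
`RM ≥ N₀ + 1`, volume, nested family `D` (2.1)–(2.2), weights in the windows with `a_{i+1} = aNext ℓ a_i c_i`, and EVERY `N`:
the operator `G′ = Δ′_a^{−1}` has majorant `C·L^{2j}·e^{−½δ₀d(y,y′)}` on the blocks AND the remainder `G′R^N = G′ − G′₀Σ_{n<N}Rⁿ`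
of the random walk representation (2.50) has majorant `C·2^{−N}·L^{2j}·e^{−½δ₀d(y,y′)}` — the partial sums of (2.50)
converge to `G′` geometrically in the norm of the first entry of (2.67) (majorants of `R` (2.64) and `G′₀`, Lemma 2.1 on
the box, §1 with `α′ = ½`, `θc ≤ ½` from «M sufficiently large»).
[cite: Balaban1984PropagatorsII, Proposition 2.2 p.234 («The random walk representation (2.50) is convergent in the norms defined by these inequalities»), (2.50) p.232, (2.64)–(2.66) p.234] -/
theorem prop22_series_first_multiLevelBox (d ℓ : ℕ) (hℓ : 1 ≤ ℓ) (aminus aplus a2minus a2plus : ℝ) (ha : 0 < aminus)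
    (ha2 : 0 < a2minus) :
    ∃ δ₀ C M₀ : ℝ, ∃ N₀ : ℕ, 0 < δ₀ ∧ 0 < C ∧ 0 < M₀ ∧ 0 < N₀ ∧
      ∀ (k Mh R : ℕ), 3 ≤ Mh → M₀ ≤ ((ℓ : ℝ) + 1) * Mh → 2 * (ℓ + 1) ≤ R → N₀ + 1 ≤ R * ((ℓ + 1) * Mh) →
      ∀ (P : Fin (d + 1) → ℕ) (hP : ∀ μ, 1 ≤ P μ) (D : Domains d ℓ Mh k P R) (a c : ℕ → ℝ),
        (∀ i, aminus ≤ a i ∧ a i ≤ aplus) → (∀ i, a2minus ≤ c i ∧ c i ≤ a2plus) →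
        (∀ i, a (i + 1) = aNext ℓ (a i) (c i)) → ∀ N : ℕ,
        HasMajorant (g := geom D) (blkOf D) (Matrix.toLin' (gml (N0 ℓ Mh k P) ℓ k D.lev a))
            (fun y y' => C * ((ℓ : ℝ) + 1) ^ (2 * y.1.1) * Real.exp (-(δ₀ / 2 * (geom D).dist y y')))
          ∧ HasMajorant (g := geom D) (blkOf D)
            (Matrix.toLin' (gml (N0 ℓ Mh k P) ℓ k D.lev a * rML D a c hP ^ N))
            (fun y y' => C * (1 / 2) ^ N * ((ℓ : ℝ) + 1) ^ (2 * y.1.1) * Real.exp (-(δ₀ / 2 * (geom D).dist y y'))) := by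
  obtain ⟨δ₁, K, hδ₁, hK, hRmaj⟩ := rML_majorant d ℓ hℓ aminus aplus a2minus a2plus ha ha2
  obtain ⟨δ₂, A, hδ₂, hA, hGmaj⟩ := gZeroML_majorant d ℓ hℓ aminus aplus a2minus a2plus ha ha2
  have hL0 : (0 : ℝ) < (ℓ : ℝ) + 1 := by positivity
  have hL1 : (1 : ℝ) ≤ (ℓ : ℝ) + 1 := by linarith [(Nat.cast_nonneg ℓ : (0 : ℝ) ≤ ℓ)]
  -- the rate `δ₀ = min(δ₁, δ₂)/(d+1)` and the (2.59)-threshold `N₀`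
  set δ₀ : ℝ := min δ₁ δ₂ / (d + 1) with hδ₀
  have hδ₀pos : 0 < δ₀ := by rw [hδ₀]; exact div_pos (lt_min hδ₁ hδ₂) (by positivity)
  set N₀ : ℕ := ⌈4 * ((d : ℝ) + 1) * ((ℓ : ℝ) + 1) / (1 / 2 * δ₀)⌉₊ + 1 with hN₀
  have hN₀pos : 0 < N₀ := by rw [hN₀]; omega
  have hθlt : Real.exp (-(1 / 2 * δ₀)) * ((ℓ : ℝ) + 1) ^ ((2 * (d + 1 : ℕ) : ℝ) / N₀) < 1 := by
    refine theta_lt_one_of_log hL0 hN₀pos ?_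
    have hlog : Real.log ((ℓ : ℝ) + 1) ≤ (ℓ : ℝ) + 1 := (Real.log_le_sub_one_of_pos hL0).trans (by linarith)
    have hN₀ge : 4 * ((d : ℝ) + 1) * ((ℓ : ℝ) + 1) / (1 / 2 * δ₀) < (N₀ : ℝ) := by
      rw [hN₀]; push_cast
      exact lt_of_le_of_lt (Nat.le_ceil _) (by linarith)
    have hσ : (0 : ℝ) < 1 / 2 * δ₀ := by positivity
    rw [div_lt_iff₀ hσ] at hN₀ge
    push_cast
    nlinarith [mul_nonneg (by positivity : (0 : ℝ) ≤ 2 * ((d : ℝ) + 1)) (Real.log_nonneg hL1)]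
  -- the (2.61)-constant and «M sufficiently large»
  set cK : ℝ := K261 N₀ (d + 1) ((ℓ : ℝ) + 1) 1 (1 / 2 * δ₀) with hcK
  have hcK0 : 0 ≤ cK := K261_nonneg (by positivity) zero_le_one
  set M₀ : ℝ := 2 * K * cK + 1 with hM₀
  refine ⟨δ₀, 2 * A * cK + 1, M₀, N₀, hδ₀pos, by positivity, by positivity, hN₀pos, ?_⟩
  intro k Mh R hMh hM hR hRM P hP D a c haw hcw hac N
  have hMh1 : 1 ≤ Mh := le_trans (by norm_num) hMh
  have hMh2 : 2 ≤ Mh := le_trans (by norm_num) hMh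
  have hMpos : (0 : ℝ) < ((ℓ : ℝ) + 1) * Mh := by
    have : (1 : ℝ) ≤ Mh := by exact_mod_cast hMh1
    positivity
  -- the majorants of `R` and `G′₀`, at the common rate `δ₀`
  set θ : ℝ := K / (((ℓ : ℝ) + 1) * Mh) with hθ
  have hθ0 : 0 ≤ θ := by positivity
  have hdnn : ∀ y y' : (geom D).Site, 0 ≤ (geom D).dist y y' := (triangle_refl_nonneg D hMh1 hP).2.2
  have hrate : ∀ (δ : ℝ), min δ₁ δ₂ ≤ δ → ∀ y y' : (geom D).Site,
      Real.exp (-(δ / (d + 1) * (geom D).dist y y')) ≤ Real.exp (-(δ₀ * (geom D).dist y y')) := by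
    intro δ hδ y y'
    rw [Real.exp_le_exp, hδ₀, neg_le_neg_iff]
    exact mul_le_mul_of_nonneg_right (div_le_div_of_nonneg_right hδ (by positivity)) (hdnn y y')
  have hRm : HasMajorant (g := geom D) (blkOf D) (Matrix.toLin' (rML D a c hP))
      (fun y y' => θ * Real.exp (-(δ₀ * (geom D).dist y y'))) :=
    hasMajorant_mono (blkOf D) (hRmaj k Mh R hMh hR P hP D a c haw hcw) fun y y' =>
      mul_le_mul_of_nonneg_left (hrate δ₁ (min_le_left _ _) y y') hθ0
  have hGm : HasMajorant (g := geom D) (blkOf D) (Matrix.toLin' (gZeroML D a c hP))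
      (fun y y' => A * ((ℓ : ℝ) + 1) ^ (2 * y.1.1) * Real.exp (-(δ₀ * (geom D).dist y y'))) :=
    hasMajorant_mono (blkOf D) (hGmaj k Mh R hMh hR P hP D a c haw hcw) fun y y' =>
      mul_le_mul_of_nonneg_left (hrate δ₂ (min_le_right _ _) y y') (by positivity)
  -- Lemma 2.1 on the box with `α = ½`
  obtain ⟨-, h261, -, h263⟩ := lemma21_box D hMh1 hP hN₀pos hRM hδ₀pos.le (α := 1 / 2) (by norm_num)
    (by norm_num) hθlt
  obtain ⟨htri, hrefl, -⟩ := triangle_refl_nonneg D hMh1 hP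
  -- the smallness `θ·c ≤ ½` from `M ≥ M₀`
  have hsmall : θ * cK ≤ 1 / 2 := by
    rw [hθ, div_mul_eq_mul_div, div_le_iff₀ hMpos]
    have : 2 * K * cK + 1 ≤ ((ℓ : ℝ) + 1) * Mh := hM
    nlinarith
  have hsmall' : θ * cK < 1 := by linarith
  have hq0 : 0 ≤ θ * cK := mul_nonneg hθ0 hcK0
  have hinv : (1 - θ * cK)⁻¹ ≤ 2 := by
    rw [inv_le_comm₀ (by linarith) (by norm_num)]; linarith
  -- the fixed point, the chain and its tail
  have hfix := fixedPoint_gml D (c := c) hℓ hR hP hMh2 (fun i => lt_of_lt_of_le ha (haw i).1)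
    (fun i => lt_of_lt_of_le ha2 (hcw i).1) hac
  have hchain := majorant_of_fixedPoint_266W (g := geom D) (blkOf D) cK δ₀ (1 / 2) θ A
    (fun y => ((ℓ : ℝ) + 1) ^ (2 * y.1.1)) hA.le (fun y => by positivity) hθ0 hcK0
    (by nlinarith [hδ₀pos.le] : (0 : ℝ) ≤ (1 - 1 / 2) * δ₀) htri hrefl hdnn h261 h263 hsmall' hGm hRm hfix
  have htail := majorant_remainder_266W (g := geom D) (blkOf D) cK δ₀ (1 / 2) θ A
    (fun y => ((ℓ : ℝ) + 1) ^ (2 * y.1.1)) hA.le (fun y => by positivity) hθ0 hcK0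
    (by nlinarith [hδ₀pos.le] : (0 : ℝ) ≤ (1 - 1 / 2) * δ₀) htri hrefl hdnn h261 h263 hsmall' hGm hRm hfix N
  have hrate2 : ∀ y y' : (geom D).Site,
      Real.exp (-((1 - 1 / 2) * δ₀ * (geom D).dist y y')) = Real.exp (-(δ₀ / 2 * (geom D).dist y y')) := by
    intro y y'; congr 1; ring
  have h1 : A * cK * (1 - θ * cK)⁻¹ ≤ 2 * A * cK + 1 := by
    have : A * cK * (1 - θ * cK)⁻¹ ≤ A * cK * 2 := mul_le_mul_of_nonneg_left hinv (by positivity)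
    linarith
  refine ⟨?_, ?_⟩
  · refine hasMajorant_mono (g := geom D) (blkOf D) hchain fun y y' => ?_
    rw [← hrate2]
    have hP0 : 0 ≤ ((ℓ : ℝ) + 1) ^ (2 * y.1.1) * Real.exp (-((1 - 1 / 2) * δ₀ * (geom D).dist y y')) := by positivity
    calc A * cK * (1 - θ * cK)⁻¹ * ((ℓ : ℝ) + 1) ^ (2 * y.1.1) * Real.exp (-((1 - 1 / 2) * δ₀ * (geom D).dist y y'))
        = A * cK * (1 - θ * cK)⁻¹ * (((ℓ : ℝ) + 1) ^ (2 * y.1.1) * Real.exp (-((1 - 1 / 2) * δ₀ * (geom D).dist y y'))) := by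
          ring
      _ ≤ (2 * A * cK + 1) * (((ℓ : ℝ) + 1) ^ (2 * y.1.1) * Real.exp (-((1 - 1 / 2) * δ₀ * (geom D).dist y y'))) :=
          mul_le_mul_of_nonneg_right h1 hP0
      _ = _ := by ring
  · rw [Matrix.toLin'_mul, Matrix.toLin'_pow, ← Module.End.mul_eq_comp]
    refine hasMajorant_mono (g := geom D) (blkOf D) htail fun y y' => ?_
    rw [← hrate2]
    have hP0 : 0 ≤ ((ℓ : ℝ) + 1) ^ (2 * y.1.1) * Real.exp (-((1 - 1 / 2) * δ₀ * (geom D).dist y y')) := by positivity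
    -- `(θc)^N ≤ (½)^N`
    have hpow : (θ * cK) ^ N ≤ (1 / 2) ^ N := pow_le_pow_left₀ hq0 hsmall N
    have hpow0 : 0 ≤ (θ * cK) ^ N := pow_nonneg hq0 N
    have h2 : A * cK * (θ * cK) ^ N * (1 - θ * cK)⁻¹ ≤ (2 * A * cK + 1) * (1 / 2) ^ N := by
      calc A * cK * (θ * cK) ^ N * (1 - θ * cK)⁻¹ = (A * cK * (1 - θ * cK)⁻¹) * (θ * cK) ^ N := by ring
        _ ≤ (2 * A * cK + 1) * (1 / 2) ^ N := mul_le_mul h1 hpow hpow0 (by positivity)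
    calc A * cK * (θ * cK) ^ N * (1 - θ * cK)⁻¹ * ((ℓ : ℝ) + 1) ^ (2 * y.1.1)
          * Real.exp (-((1 - 1 / 2) * δ₀ * (geom D).dist y y'))
        = A * cK * (θ * cK) ^ N * (1 - θ * cK)⁻¹
          * (((ℓ : ℝ) + 1) ^ (2 * y.1.1) * Real.exp (-((1 - 1 / 2) * δ₀ * (geom D).dist y y'))) := by ring
      _ ≤ (2 * A * cK + 1) * (1 / 2) ^ N
          * (((ℓ : ℝ) + 1) ^ (2 * y.1.1) * Real.exp (-((1 - 1 / 2) * δ₀ * (geom D).dist y y'))) :=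
          mul_le_mul_of_nonneg_right h2 hP0
      _ = _ := by ring

/-- **[B6] PROPOSITION 2.2, CONVERGENCE CLAUSE, SECOND ENTRY (`∇_μG′`), GENUINE `k`-LEVEL OPERATOR**: same quantifiers;
for every axis `μ` and every `N`, `∇_μG′` has majorant `C·L^{j}·e^{−½δ₀d}` and the remainder `∇_μG′R^N = ∇_μ(G′ − G′₀Σ_{n<N}Rⁿ)`
has majorant `C·2^{−N}·L^{j}·e^{−½δ₀d}` (fixed point `∇G′ = ∇G′₀ + (∇G′)R` of file 6, majorant of `∇G′₀`, §1).
[cite: Balaban1984PropagatorsII, Proposition 2.2 p.234 («(2.50) is convergent in the norms defined by these inequalities»), (2.50) p.232, (2.64)–(2.67) p.234] -/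
theorem prop22_series_second_multiLevelBox (d ℓ : ℕ) (hℓ : 1 ≤ ℓ) (aminus aplus a2minus a2plus : ℝ)
    (ha : 0 < aminus) (ha2 : 0 < a2minus) :
    ∃ δ₀ C M₀ : ℝ, ∃ N₀ : ℕ, 0 < δ₀ ∧ 0 < C ∧ 0 < M₀ ∧ 0 < N₀ ∧
      ∀ (k Mh R : ℕ), 3 ≤ Mh → M₀ ≤ ((ℓ : ℝ) + 1) * Mh → 2 * (ℓ + 1) ≤ R → N₀ + 1 ≤ R * ((ℓ + 1) * Mh) →
      ∀ (P : Fin (d + 1) → ℕ) (hP : ∀ μ, 1 ≤ P μ) (D : Domains d ℓ Mh k P R) (a c : ℕ → ℝ),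
        (∀ i, aminus ≤ a i ∧ a i ≤ aplus) → (∀ i, a2minus ≤ c i ∧ c i ≤ a2plus) →
        (∀ i, a (i + 1) = aNext ℓ (a i) (c i)) → ∀ (μ : Fin (d + 1)) (N : ℕ),
        HasMajorant (g := geom D) (blkOf D)
            (Matrix.toLin' (dMat (N0 ℓ Mh k P) μ * gml (N0 ℓ Mh k P) ℓ k D.lev a))
            (fun y y' => C * ((ℓ : ℝ) + 1) ^ y.1.1 * Real.exp (-(δ₀ / 2 * (geom D).dist y y')))
          ∧ HasMajorant (g := geom D) (blkOf D)
            (Matrix.toLin' (dMat (N0 ℓ Mh k P) μ * gml (N0 ℓ Mh k P) ℓ k D.lev a * rML D a c hP ^ N))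
            (fun y y' => C * (1 / 2) ^ N * ((ℓ : ℝ) + 1) ^ y.1.1 * Real.exp (-(δ₀ / 2 * (geom D).dist y y'))) := by
  obtain ⟨δ₁, K, hδ₁, hK, hRmaj⟩ := rML_majorant d ℓ hℓ aminus aplus a2minus a2plus ha ha2
  obtain ⟨δ₂, A, hδ₂, hA, hGmaj⟩ := dMat_gZeroML_majorant d ℓ hℓ aminus aplus a2minus a2plus ha ha2
  have hL0 : (0 : ℝ) < (ℓ : ℝ) + 1 := by positivity
  have hL1 : (1 : ℝ) ≤ (ℓ : ℝ) + 1 := by linarith [(Nat.cast_nonneg ℓ : (0 : ℝ) ≤ ℓ)]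
  set δ₀ : ℝ := min δ₁ δ₂ / (d + 1) with hδ₀
  have hδ₀pos : 0 < δ₀ := by rw [hδ₀]; exact div_pos (lt_min hδ₁ hδ₂) (by positivity)
  set N₀ : ℕ := ⌈4 * ((d : ℝ) + 1) * ((ℓ : ℝ) + 1) / (1 / 2 * δ₀)⌉₊ + 1 with hN₀
  have hN₀pos : 0 < N₀ := by rw [hN₀]; omega
  have hθlt : Real.exp (-(1 / 2 * δ₀)) * ((ℓ : ℝ) + 1) ^ ((2 * (d + 1 : ℕ) : ℝ) / N₀) < 1 := by
    refine theta_lt_one_of_log hL0 hN₀pos ?_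
    have hlog : Real.log ((ℓ : ℝ) + 1) ≤ (ℓ : ℝ) + 1 := (Real.log_le_sub_one_of_pos hL0).trans (by linarith)
    have hN₀ge : 4 * ((d : ℝ) + 1) * ((ℓ : ℝ) + 1) / (1 / 2 * δ₀) < (N₀ : ℝ) := by
      rw [hN₀]; push_cast
      exact lt_of_le_of_lt (Nat.le_ceil _) (by linarith)
    have hσ : (0 : ℝ) < 1 / 2 * δ₀ := by positivity
    rw [div_lt_iff₀ hσ] at hN₀ge
    push_cast
    nlinarith [mul_nonneg (by positivity : (0 : ℝ) ≤ 2 * ((d : ℝ) + 1)) (Real.log_nonneg hL1)]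
  set cK : ℝ := K261 N₀ (d + 1) ((ℓ : ℝ) + 1) 1 (1 / 2 * δ₀) with hcK
  have hcK0 : 0 ≤ cK := K261_nonneg (by positivity) zero_le_one
  set M₀ : ℝ := 2 * K * cK + 1 with hM₀
  refine ⟨δ₀, 2 * A * cK + 1, M₀, N₀, hδ₀pos, by positivity, by positivity, hN₀pos, ?_⟩
  intro k Mh R hMh hM hR hRM P hP D a c haw hcw hac μ N
  have hMh1 : 1 ≤ Mh := le_trans (by norm_num) hMh
  have hMh2 : 2 ≤ Mh := le_trans (by norm_num) hMh
  have hMpos : (0 : ℝ) < ((ℓ : ℝ) + 1) * Mh := by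
    have : (1 : ℝ) ≤ Mh := by exact_mod_cast hMh1
    positivity
  set θ : ℝ := K / (((ℓ : ℝ) + 1) * Mh) with hθ
  have hθ0 : 0 ≤ θ := by positivity
  have hdnn : ∀ y y' : (geom D).Site, 0 ≤ (geom D).dist y y' := (triangle_refl_nonneg D hMh1 hP).2.2
  have hrate : ∀ (δ : ℝ), min δ₁ δ₂ ≤ δ → ∀ y y' : (geom D).Site,
      Real.exp (-(δ / (d + 1) * (geom D).dist y y')) ≤ Real.exp (-(δ₀ * (geom D).dist y y')) := by
    intro δ hδ y y'
    rw [Real.exp_le_exp, hδ₀, neg_le_neg_iff]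
    exact mul_le_mul_of_nonneg_right (div_le_div_of_nonneg_right hδ (by positivity)) (hdnn y y')
  have hRm : HasMajorant (g := geom D) (blkOf D) (Matrix.toLin' (rML D a c hP))
      (fun y y' => θ * Real.exp (-(δ₀ * (geom D).dist y y'))) :=
    hasMajorant_mono (blkOf D) (hRmaj k Mh R hMh hR P hP D a c haw hcw) fun y y' =>
      mul_le_mul_of_nonneg_left (hrate δ₁ (min_le_left _ _) y y') hθ0
  have hGm : HasMajorant (g := geom D) (blkOf D) (Matrix.toLin' (dMat (N0 ℓ Mh k P) μ * gZeroML D a c hP))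
      (fun y y' => A * ((ℓ : ℝ) + 1) ^ y.1.1 * Real.exp (-(δ₀ * (geom D).dist y y'))) :=
    hasMajorant_mono (blkOf D) (hGmaj k Mh R hMh hR P hP D a c haw hcw μ) fun y y' =>
      mul_le_mul_of_nonneg_left (hrate δ₂ (min_le_right _ _) y y') (by positivity)
  obtain ⟨-, h261, -, h263⟩ := lemma21_box D hMh1 hP hN₀pos hRM hδ₀pos.le (α := 1 / 2) (by norm_num)
    (by norm_num) hθlt
  obtain ⟨htri, hrefl, -⟩ := triangle_refl_nonneg D hMh1 hP
  have hsmall : θ * cK ≤ 1 / 2 := by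
    rw [hθ, div_mul_eq_mul_div, div_le_iff₀ hMpos]
    have : 2 * K * cK + 1 ≤ ((ℓ : ℝ) + 1) * Mh := hM
    nlinarith
  have hsmall' : θ * cK < 1 := by linarith
  have hq0 : 0 ≤ θ * cK := mul_nonneg hθ0 hcK0
  have hinv : (1 - θ * cK)⁻¹ ≤ 2 := by
    rw [inv_le_comm₀ (by linarith) (by norm_num)]; linarith
  have hfix := fixedPoint_dMat_gml D (c := c) hℓ hR hP hMh2 (fun i => lt_of_lt_of_le ha (haw i).1)
    (fun i => lt_of_lt_of_le ha2 (hcw i).1) hac μ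
  have hchain := majorant_of_fixedPoint_266W (g := geom D) (blkOf D) cK δ₀ (1 / 2) θ A
    (fun y => ((ℓ : ℝ) + 1) ^ y.1.1) hA.le (fun y => by positivity) hθ0 hcK0
    (by nlinarith [hδ₀pos.le] : (0 : ℝ) ≤ (1 - 1 / 2) * δ₀) htri hrefl hdnn h261 h263 hsmall' hGm hRm hfix
  have htail := majorant_remainder_266W (g := geom D) (blkOf D) cK δ₀ (1 / 2) θ A
    (fun y => ((ℓ : ℝ) + 1) ^ y.1.1) hA.le (fun y => by positivity) hθ0 hcK0
    (by nlinarith [hδ₀pos.le] : (0 : ℝ) ≤ (1 - 1 / 2) * δ₀) htri hrefl hdnn h261 h263 hsmall' hGm hRm hfix N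
  have hrate2 : ∀ y y' : (geom D).Site,
      Real.exp (-((1 - 1 / 2) * δ₀ * (geom D).dist y y')) = Real.exp (-(δ₀ / 2 * (geom D).dist y y')) := by
    intro y y'; congr 1; ring
  have h1 : A * cK * (1 - θ * cK)⁻¹ ≤ 2 * A * cK + 1 := by
    have : A * cK * (1 - θ * cK)⁻¹ ≤ A * cK * 2 := mul_le_mul_of_nonneg_left hinv (by positivity)
    linarith
  refine ⟨?_, ?_⟩
  · refine hasMajorant_mono (g := geom D) (blkOf D) hchain fun y y' => ?_
    rw [← hrate2]
    have hP0 : 0 ≤ ((ℓ : ℝ) + 1) ^ y.1.1 * Real.exp (-((1 - 1 / 2) * δ₀ * (geom D).dist y y')) := by positivity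
    calc A * cK * (1 - θ * cK)⁻¹ * ((ℓ : ℝ) + 1) ^ y.1.1 * Real.exp (-((1 - 1 / 2) * δ₀ * (geom D).dist y y'))
        = A * cK * (1 - θ * cK)⁻¹ * (((ℓ : ℝ) + 1) ^ y.1.1 * Real.exp (-((1 - 1 / 2) * δ₀ * (geom D).dist y y'))) := by
          ring
      _ ≤ (2 * A * cK + 1) * (((ℓ : ℝ) + 1) ^ y.1.1 * Real.exp (-((1 - 1 / 2) * δ₀ * (geom D).dist y y'))) :=
          mul_le_mul_of_nonneg_right h1 hP0
      _ = _ := by ring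
  · rw [Matrix.toLin'_mul, Matrix.toLin'_pow, ← Module.End.mul_eq_comp]
    refine hasMajorant_mono (g := geom D) (blkOf D) htail fun y y' => ?_
    rw [← hrate2]
    have hP0 : 0 ≤ ((ℓ : ℝ) + 1) ^ y.1.1 * Real.exp (-((1 - 1 / 2) * δ₀ * (geom D).dist y y')) := by positivity
    have hpow : (θ * cK) ^ N ≤ (1 / 2) ^ N := pow_le_pow_left₀ hq0 hsmall N
    have hpow0 : 0 ≤ (θ * cK) ^ N := pow_nonneg hq0 N
    have h2 : A * cK * (θ * cK) ^ N * (1 - θ * cK)⁻¹ ≤ (2 * A * cK + 1) * (1 / 2) ^ N := by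
      calc A * cK * (θ * cK) ^ N * (1 - θ * cK)⁻¹ = (A * cK * (1 - θ * cK)⁻¹) * (θ * cK) ^ N := by ring
        _ ≤ (2 * A * cK + 1) * (1 / 2) ^ N := mul_le_mul h1 hpow hpow0 (by positivity)
    calc A * cK * (θ * cK) ^ N * (1 - θ * cK)⁻¹ * ((ℓ : ℝ) + 1) ^ y.1.1
          * Real.exp (-((1 - 1 / 2) * δ₀ * (geom D).dist y y'))
        = A * cK * (θ * cK) ^ N * (1 - θ * cK)⁻¹
          * (((ℓ : ℝ) + 1) ^ y.1.1 * Real.exp (-((1 - 1 / 2) * δ₀ * (geom D).dist y y'))) := by ring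
      _ ≤ (2 * A * cK + 1) * (1 / 2) ^ N
          * (((ℓ : ℝ) + 1) ^ y.1.1 * Real.exp (-((1 - 1 / 2) * δ₀ * (geom D).dist y y'))) :=
          mul_le_mul_of_nonneg_right h2 hP0
      _ = _ := by ring

end KLevel

/-! ## §3 The lifted Hölder functional of the fourth entry: the remainders of (2.50), printed quantifier order -/

section Holder

variable {ℓ Mh k R : ℕ} {P : Fin (d + 1) → ℕ}

/-- the lifted pair functional of a remainder: `liftL T(M·R^N) = liftL T(M) · (liftR R)^N` (`T(M·M′) = T(M) ∘ M′`,
`liftL A · liftR R = liftL (A ∘ R)`). [cite: Balaban1984PropagatorsII, (2.50) p.232, (2.52)–(2.55) p.232, dictionary] -/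
theorem liftL_holderOp_mul_pow (D : B6MultiLevelBoxOperatorL0.Domains d ℓ Mh k P R) (μ : Fin (d + 1)) (α : ℝ)
    (M Rm : Matrix ↥(boxDom (N0 ℓ Mh k P)) ↥(boxDom (N0 ℓ Mh k P)) ℝ) (N : ℕ) :
    liftL (holderOp D μ α (M * Rm ^ N))
      = liftL (holderOp D μ α M) * (liftR (Y := HPair D μ) (Matrix.toLin' Rm)) ^ N := by
  induction N with
  | zero => rw [pow_zero, Matrix.mul_one, pow_zero, mul_one]
  | succ N ih => rw [pow_succ, ← Matrix.mul_assoc, holderOp_mul, ← liftL_mul_liftR, ih, pow_succ, mul_assoc]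

/-- **[B6] PROPOSITION 2.2, CONVERGENCE CLAUSE, FOURTH ENTRY (`‖ζ∇_μG′λ‖_α`), GENUINE `k`-LEVEL OPERATOR, PRINTED
QUANTIFIER ORDER**: there are `δ₀, M₀ > 0`, `N₀ ≥ 1` such that for every `0 ≤ α < 1` there is `C = C(α) > 0` with, for
every `k`, `M_h ≥ 3`, `L·M_h ≥ M₀`, `R ≥ 2L`, `RM ≥ N₀ + 1`, volume, nested family, weights in the windows
(`a_{i+1} = aNext ℓ a_i c_i`), axis `μ` and EVERY `N`: the lifted pair functional of `∇_μG′` has majorant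
`C·(L^{j})^{1−α}·e^{−½δ₀d}` on `pairs ⊕ sites` AND that of the remainder `∇_μ(G′R^N) = ∇_μ(G′ − G′₀Σ_{n<N}Rⁿ)` has majorant
`C·2^{−N}·(L^{j})^{1−α}·e^{−½δ₀d}` — the Hölder norm of a derivative of the partial sums of (2.50) converges geometrically (the
lifted fixed point of file 11, §1 on `pairs ⊕ sites`, `liftL_holderOp_mul_pow`).
[cite: Balaban1984PropagatorsII, Proposition 2.2 p.234 («(2.50) is convergent in the norms defined by these inequalities»; fourth entry «(L^jη)^{1−α}(‖ζ‖_α + |ζ|)»), (2.50) p.232, (2.64)–(2.66) p.234; Balaban1983RegularityDecay, Theorem (1.9) p.573] -/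
theorem prop22_series_fourth_multiLevelBox_unif (d ℓ : ℕ) (hℓ : 1 ≤ ℓ) (aminus aplus a2minus a2plus : ℝ)
    (ha : 0 < aminus) (ha2 : 0 < a2minus) :
    ∃ δ₀ M₀ : ℝ, ∃ N₀ : ℕ, 0 < δ₀ ∧ 0 < M₀ ∧ 0 < N₀ ∧ ∀ (α : ℝ), 0 ≤ α → α < 1 → ∃ C : ℝ, 0 < C ∧
      ∀ (k Mh R : ℕ), 3 ≤ Mh → M₀ ≤ ((ℓ : ℝ) + 1) * Mh → 2 * (ℓ + 1) ≤ R → N₀ + 1 ≤ R * ((ℓ + 1) * Mh) →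
      ∀ (P : Fin (d + 1) → ℕ) (hP : ∀ μ, 1 ≤ P μ) (D : Domains d ℓ Mh k P R) (a c : ℕ → ℝ),
        (∀ i, aminus ≤ a i ∧ a i ≤ aplus) → (∀ i, a2minus ≤ c i ∧ c i ≤ a2plus) →
        (∀ i, a (i + 1) = aNext ℓ (a i) (c i)) → ∀ (μ : Fin (d + 1)) (N : ℕ),
        HasMajorant (g := geom D) (Sum.elim (blkP D μ) (blkOf D))
            (liftL (holderOp D μ α (gml (N0 ℓ Mh k P) ℓ k D.lev a)))
            (fun y y' => C * (((ℓ : ℝ) + 1) ^ y.1.1) ^ (1 - α) * Real.exp (-(δ₀ / 2 * (geom D).dist y y')))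
          ∧ HasMajorant (g := geom D) (Sum.elim (blkP D μ) (blkOf D))
            (liftL (holderOp D μ α (gml (N0 ℓ Mh k P) ℓ k D.lev a * rML D a c hP ^ N)))
            (fun y y' => C * (1 / 2) ^ N * (((ℓ : ℝ) + 1) ^ y.1.1) ^ (1 - α)
              * Real.exp (-(δ₀ / 2 * (geom D).dist y y'))) := by
  obtain ⟨δ₁, K, hδ₁, hK, hRmaj⟩ := rML_majorant d ℓ hℓ aminus aplus a2minus a2plus ha ha2
  obtain ⟨δ₂, hδ₂, hGrowA⟩ := holderZero_rowBound_unif d ℓ hℓ aminus aplus a2minus a2plus ha ha2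
  have hL0 : (0 : ℝ) < (ℓ : ℝ) + 1 := by positivity
  have hL1 : (1 : ℝ) ≤ (ℓ : ℝ) + 1 := by linarith [(Nat.cast_nonneg ℓ : (0 : ℝ) ≤ ℓ)]
  set δ₀ : ℝ := min δ₁ δ₂ / (d + 1) with hδ₀
  have hδ₀pos : 0 < δ₀ := by rw [hδ₀]; exact div_pos (lt_min hδ₁ hδ₂) (by positivity)
  set N₀ : ℕ := ⌈4 * ((d : ℝ) + 1) * ((ℓ : ℝ) + 1) / (1 / 2 * δ₀)⌉₊ + 1 with hN₀
  have hN₀pos : 0 < N₀ := by rw [hN₀]; omega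
  have hθlt : Real.exp (-(1 / 2 * δ₀)) * ((ℓ : ℝ) + 1) ^ ((2 * (d + 1 : ℕ) : ℝ) / N₀) < 1 := by
    refine theta_lt_one_of_log hL0 hN₀pos ?_
    have hlog : Real.log ((ℓ : ℝ) + 1) ≤ (ℓ : ℝ) + 1 := (Real.log_le_sub_one_of_pos hL0).trans (by linarith)
    have hN₀ge : 4 * ((d : ℝ) + 1) * ((ℓ : ℝ) + 1) / (1 / 2 * δ₀) < (N₀ : ℝ) := by
      rw [hN₀]; push_cast
      exact lt_of_le_of_lt (Nat.le_ceil _) (by linarith)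
    have hσ : (0 : ℝ) < 1 / 2 * δ₀ := by positivity
    rw [div_lt_iff₀ hσ] at hN₀ge
    push_cast
    nlinarith [mul_nonneg (by positivity : (0 : ℝ) ≤ 2 * ((d : ℝ) + 1)) (Real.log_nonneg hL1)]
  set cK : ℝ := K261 N₀ (d + 1) ((ℓ : ℝ) + 1) 1 (1 / 2 * δ₀) with hcK
  have hcK0 : 0 ≤ cK := K261_nonneg (by positivity) zero_le_one
  set M₀ : ℝ := 2 * K * cK + 1 with hM₀
  refine ⟨δ₀, M₀, N₀, hδ₀pos, by positivity, hN₀pos, fun α hα0 hα1 => ?_⟩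
  obtain ⟨A, hA, hGrow⟩ := hGrowA α hα0 hα1
  refine ⟨2 * A * cK + 1, by positivity, ?_⟩
  intro k Mh R hMh hM hR hRM P hP D a c haw hcw hac μ N
  have hMh1 : 1 ≤ Mh := le_trans (by norm_num) hMh
  have hMh2 : 2 ≤ Mh := le_trans (by norm_num) hMh
  have hMpos : (0 : ℝ) < ((ℓ : ℝ) + 1) * Mh := by
    have : (1 : ℝ) ≤ Mh := by exact_mod_cast hMh1
    positivity
  set θ : ℝ := K / (((ℓ : ℝ) + 1) * Mh) with hθ
  have hθ0 : 0 ≤ θ := by positivity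
  have hdnn : ∀ y y' : (geom D).Site, 0 ≤ (geom D).dist y y' := (triangle_refl_nonneg D hMh1 hP).2.2
  have hrate : ∀ (δ : ℝ), min δ₁ δ₂ ≤ δ → ∀ y y' : (geom D).Site,
      Real.exp (-(δ / (d + 1) * (geom D).dist y y')) ≤ Real.exp (-(δ₀ * (geom D).dist y y')) := by
    intro δ hδ y y'
    rw [Real.exp_le_exp, hδ₀, neg_le_neg_iff]
    exact mul_le_mul_of_nonneg_right (div_le_div_of_nonneg_right hδ (by positivity)) (hdnn y y')
  have hRm0 : HasMajorant (g := geom D) (blkOf D) (Matrix.toLin' (rML D a c hP))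
      (fun y y' => θ * Real.exp (-(δ₀ * (geom D).dist y y'))) :=
    hasMajorant_mono (blkOf D) (hRmaj k Mh R hMh hR P hP D a c haw hcw) fun y y' =>
      mul_le_mul_of_nonneg_left (hrate δ₁ (min_le_left _ _) y y') hθ0
  have hRm : HasMajorant (g := geom D) (Sum.elim (blkP D μ) (blkOf D))
      (liftR (Y := HPair D μ) (Matrix.toLin' (rML D a c hP)))
      (fun y y' => θ * Real.exp (-(δ₀ * (geom D).dist y y'))) :=
    hasMajorant_liftR (g := geom D) (blkOf D) (blkP D μ) (K := fun y y' => θ * Real.exp (-(δ₀ * (geom D).dist y y')))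
      (fun y y' => by positivity) hRm0
  have hGm : HasMajorant (g := geom D) (Sum.elim (blkP D μ) (blkOf D))
      (liftL (holderOp D μ α (gZeroML D a c hP)))
      (fun y y' => A * (((ℓ : ℝ) + 1) ^ y.1.1) ^ (1 - α) * Real.exp (-(δ₀ * (geom D).dist y y'))) := by
    refine hasMajorant_liftL (g := geom D) (blkOf D) (blkP D μ)
      (K := fun y y' => A * (((ℓ : ℝ) + 1) ^ y.1.1) ^ (1 - α) * Real.exp (-(δ₀ * (geom D).dist y y')))
      (fun y y' => by positivity) fun y' lam B hlam p => ?_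
    refine (hGrow k Mh R hMh hR P hP D a c haw hcw μ y' lam B hlam p).trans ?_
    refine mul_le_mul_of_nonneg_right ?_ hlam.nonneg
    exact mul_le_mul_of_nonneg_left (hrate δ₂ (min_le_right _ _) _ _) (by positivity)
  obtain ⟨-, h261, -, h263⟩ := lemma21_box D hMh1 hP hN₀pos hRM hδ₀pos.le (α := 1 / 2) (by norm_num)
    (by norm_num) hθlt
  obtain ⟨htri, hrefl, -⟩ := triangle_refl_nonneg D hMh1 hP
  have hsmall : θ * cK ≤ 1 / 2 := by
    rw [hθ, div_mul_eq_mul_div, div_le_iff₀ hMpos]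
    have : 2 * K * cK + 1 ≤ ((ℓ : ℝ) + 1) * Mh := hM
    nlinarith
  have hsmall' : θ * cK < 1 := by linarith
  have hq0 : 0 ≤ θ * cK := mul_nonneg hθ0 hcK0
  have hinv : (1 - θ * cK)⁻¹ ≤ 2 := by
    rw [inv_le_comm₀ (by linarith) (by norm_num)]; linarith
  have hfix := fixedPoint_holder D (c := c) hℓ hR hP hMh2 (fun i => lt_of_lt_of_le ha (haw i).1)
    (fun i => lt_of_lt_of_le ha2 (hcw i).1) hac μ α
  have hchain := majorant_of_fixedPoint_266W (g := geom D) (Sum.elim (blkP D μ) (blkOf D)) cK δ₀ (1 / 2) θ A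
    (fun y => (((ℓ : ℝ) + 1) ^ y.1.1) ^ (1 - α)) hA.le (fun y => Real.rpow_nonneg (by positivity) _) hθ0 hcK0
    (by nlinarith [hδ₀pos.le] : (0 : ℝ) ≤ (1 - 1 / 2) * δ₀) htri hrefl hdnn h261 h263 hsmall' hGm hRm hfix
  have htail := majorant_remainder_266W (g := geom D) (Sum.elim (blkP D μ) (blkOf D)) cK δ₀ (1 / 2) θ A
    (fun y => (((ℓ : ℝ) + 1) ^ y.1.1) ^ (1 - α)) hA.le (fun y => Real.rpow_nonneg (by positivity) _) hθ0 hcK0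
    (by nlinarith [hδ₀pos.le] : (0 : ℝ) ≤ (1 - 1 / 2) * δ₀) htri hrefl hdnn h261 h263 hsmall' hGm hRm hfix N
  have hrate2 : ∀ y y' : (geom D).Site,
      Real.exp (-((1 - 1 / 2) * δ₀ * (geom D).dist y y')) = Real.exp (-(δ₀ / 2 * (geom D).dist y y')) := by
    intro y y'; congr 1; ring
  have h1 : A * cK * (1 - θ * cK)⁻¹ ≤ 2 * A * cK + 1 := by
    have : A * cK * (1 - θ * cK)⁻¹ ≤ A * cK * 2 := mul_le_mul_of_nonneg_left hinv (by positivity)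
    linarith
  refine ⟨?_, ?_⟩
  · refine hasMajorant_mono (g := geom D) (Sum.elim (blkP D μ) (blkOf D)) hchain fun y y' => ?_
    rw [← hrate2]
    have hP0 : 0 ≤ (((ℓ : ℝ) + 1) ^ y.1.1) ^ (1 - α) * Real.exp (-((1 - 1 / 2) * δ₀ * (geom D).dist y y')) :=
      mul_nonneg (Real.rpow_nonneg (by positivity) _) (Real.exp_pos _).le
    calc A * cK * (1 - θ * cK)⁻¹ * (((ℓ : ℝ) + 1) ^ y.1.1) ^ (1 - α) * Real.exp (-((1 - 1 / 2) * δ₀ * (geom D).dist y y'))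
        = A * cK * (1 - θ * cK)⁻¹
          * ((((ℓ : ℝ) + 1) ^ y.1.1) ^ (1 - α) * Real.exp (-((1 - 1 / 2) * δ₀ * (geom D).dist y y'))) := by ring
      _ ≤ (2 * A * cK + 1) * ((((ℓ : ℝ) + 1) ^ y.1.1) ^ (1 - α) * Real.exp (-((1 - 1 / 2) * δ₀ * (geom D).dist y y'))) :=
          mul_le_mul_of_nonneg_right h1 hP0
      _ = _ := by ring
  · rw [liftL_holderOp_mul_pow]
    refine hasMajorant_mono (g := geom D) (Sum.elim (blkP D μ) (blkOf D)) htail fun y y' => ?_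
    rw [← hrate2]
    have hP0 : 0 ≤ (((ℓ : ℝ) + 1) ^ y.1.1) ^ (1 - α) * Real.exp (-((1 - 1 / 2) * δ₀ * (geom D).dist y y')) :=
      mul_nonneg (Real.rpow_nonneg (by positivity) _) (Real.exp_pos _).le
    have hpow : (θ * cK) ^ N ≤ (1 / 2) ^ N := pow_le_pow_left₀ hq0 hsmall N
    have hpow0 : 0 ≤ (θ * cK) ^ N := pow_nonneg hq0 N
    have h2 : A * cK * (θ * cK) ^ N * (1 - θ * cK)⁻¹ ≤ (2 * A * cK + 1) * (1 / 2) ^ N := by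
      calc A * cK * (θ * cK) ^ N * (1 - θ * cK)⁻¹ = (A * cK * (1 - θ * cK)⁻¹) * (θ * cK) ^ N := by ring
        _ ≤ (2 * A * cK + 1) * (1 / 2) ^ N := mul_le_mul h1 hpow hpow0 (by positivity)
    calc A * cK * (θ * cK) ^ N * (1 - θ * cK)⁻¹ * (((ℓ : ℝ) + 1) ^ y.1.1) ^ (1 - α)
          * Real.exp (-((1 - 1 / 2) * δ₀ * (geom D).dist y y'))
        = A * cK * (θ * cK) ^ N * (1 - θ * cK)⁻¹
          * ((((ℓ : ℝ) + 1) ^ y.1.1) ^ (1 - α) * Real.exp (-((1 - 1 / 2) * δ₀ * (geom D).dist y y'))) := by ring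
      _ ≤ (2 * A * cK + 1) * (1 / 2) ^ N
          * ((((ℓ : ℝ) + 1) ^ y.1.1) ^ (1 - α) * Real.exp (-((1 - 1 / 2) * δ₀ * (geom D).dist y y'))) :=
          mul_le_mul_of_nonneg_right h2 hP0
      _ = _ := by ring

/-- **THE HÖLDER REMAINDER READ BACK ON THE PAIRS** (same constants): for all `x ≠ x′` of one block `B^j(y)` with
`x + e_μ`, `x′ + e_μ` in the box, `λ` supported in `B^{j′}(y′)` and every `N`, with `W_N = G′R^N = G′ − G′₀Σ_{n<N}Rⁿ`:
`|x′−x|^{−α}·|((W_Nλ)(x′+e_μ) − (W_Nλ)(x′)) − ((W_Nλ)(x+e_μ) − (W_Nλ)(x))| ≤ C·2^{−N}·(L^{j})^{1−α}·e^{−½δ₀d(y,y′)}·|λ|`.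
[cite: Balaban1984PropagatorsII, Proposition 2.2 p.234 (convergence clause, fourth entry), (2.50) p.232; Balaban1983RegularityDecay, Theorem (1.9) p.573] -/
theorem prop22_series_fourth_pointwise_multiLevelBox_unif (d ℓ : ℕ) (hℓ : 1 ≤ ℓ) (aminus aplus a2minus a2plus : ℝ)
    (ha : 0 < aminus) (ha2 : 0 < a2minus) :
    ∃ δ₀ M₀ : ℝ, ∃ N₀ : ℕ, 0 < δ₀ ∧ 0 < M₀ ∧ 0 < N₀ ∧ ∀ (α : ℝ), 0 ≤ α → α < 1 → ∃ C : ℝ, 0 < C ∧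
      ∀ (k Mh R : ℕ), 3 ≤ Mh → M₀ ≤ ((ℓ : ℝ) + 1) * Mh → 2 * (ℓ + 1) ≤ R → N₀ + 1 ≤ R * ((ℓ + 1) * Mh) →
      ∀ (P : Fin (d + 1) → ℕ) (hP : ∀ μ, 1 ≤ P μ) (D : Domains d ℓ Mh k P R) (a c : ℕ → ℝ),
        (∀ i, aminus ≤ a i ∧ a i ≤ aplus) → (∀ i, a2minus ≤ c i ∧ c i ≤ a2plus) →
        (∀ i, a (i + 1) = aNext ℓ (a i) (c i)) →
        ∀ (μ : Fin (d + 1)) (N : ℕ) (y' : ↥(bset D)) (lam : ↥(boxDom (N0 ℓ Mh k P)) → ℝ) (B : ℝ),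
          BlockSupp (g := geom D) (blkOf D) lam y' B →
          ∀ (x x' : ↥(boxDom (N0 ℓ Mh k P))), x'.1 ≠ x.1 → blkOf D x' = blkOf D x →
          ∀ (hxe : x.1 + Pi.single μ 1 ∈ boxDom (N0 ℓ Mh k P)) (hxe' : x'.1 + Pi.single μ 1 ∈ boxDom (N0 ℓ Mh k P)),
            (supNorm (x'.1 - x.1)) ^ (-α)
                * |(((gml (N0 ℓ Mh k P) ℓ k D.lev a * rML D a c hP ^ N) *ᵥ lam) ⟨x'.1 + Pi.single μ 1, hxe'⟩
                      - ((gml (N0 ℓ Mh k P) ℓ k D.lev a * rML D a c hP ^ N) *ᵥ lam) x')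
                    - (((gml (N0 ℓ Mh k P) ℓ k D.lev a * rML D a c hP ^ N) *ᵥ lam) ⟨x.1 + Pi.single μ 1, hxe⟩
                      - ((gml (N0 ℓ Mh k P) ℓ k D.lev a * rML D a c hP ^ N) *ᵥ lam) x)|
              ≤ C * (1 / 2) ^ N * (((ℓ : ℝ) + 1) ^ D.lev x.1) ^ (1 - α)
                * Real.exp (-(δ₀ / 2 * (geom D).dist (blkOf D x) y')) * B := by
  obtain ⟨δ₀, M₀, N₀, hδ₀, hM₀, hN₀, hCA⟩ :=
    prop22_series_fourth_multiLevelBox_unif d ℓ hℓ aminus aplus a2minus a2plus ha ha2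
  refine ⟨δ₀, M₀, N₀, hδ₀, hM₀, hN₀, fun α hα0 hα1 => ?_⟩
  obtain ⟨C, hC, h⟩ := hCA α hα0 hα1
  refine ⟨C, hC, ?_⟩
  intro k Mh R hMh hM hR hRM P hP D a c haw hcw hac μ N y' lam B hlam x x' hne hblk hxe hxe'
  have hmaj := (h k Mh R hMh hM hR hRM P hP D a c haw hcw hac μ N).2
  have hrow := rowBound_of_hasMajorant_liftL (g := geom D) (blkOf D) (blkP D μ) hmaj y' lam B hlam
    (⟨x, x', hne, hblk, hxe, hxe'⟩ : HPair D μ)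
  rw [holderOp_apply, abs_mul, abs_of_nonneg (Real.rpow_nonneg (supNorm_nonneg _) _)] at hrow
  exact hrow

end Holder

end

end Literature.MathematicalPhysics.QuantumFieldTheory.Balaban1983to89.B6Prop22SeriesMultiLevelBoxL0
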